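import Literature.RepresentationTheory.FiniteGroups.GLnUnipotent
import Mathlib.LinearAlgebra.Matrix.Determinant.Basic
import HarnessLib

/-!
# The Bruhat decomposition of `GL_n(F)` (existence): `G = ⋃_w U w T U`

Topic `Literature/RepresentationTheory/FiniteGroups`.  For every invertible matrix `g` over a field
there are upper unitriangular `u₁, u₂` with `u₁ g u₂` **monomial** (exactly one non-zero entry in each
row and column): `GL_n(F) = U N U = ⨆_{w ∈ S_n} B w B` (Bruhat; e.g. Carter, *Finite Groups of Lie
Type*, §2.5 / Prop. 8.2.2 for `GL_n`; Bump, *Automorphic Forms and Representations*, proof of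
Thm. 4.1.2; Steinberg, *Lectures on Chevalley Groups*, Thm. 4).  Proof by Gaussian elimination and
induction on `n`: take the first non-zero entry `p = g_{n-1,c}` of the last row, clear the rest of the
last row by column operations and the rest of column `c` by row operations, and recurse on the minor.

* `GLn.extendAlong p A` — the `(n+1) × (n+1)` matrix `A ⊕ (1)` with `A` placed on the rows/columns
  `≠ p` (via `p.succAbove`); multiplicative, preserves unitriangularity.
* `GLn.exists_isUnitUpper_mul_mul_eq_monomial` (matrices), `GLn.exists_bruhat` (in `GL_n(F)`):
  `∃ u₁ u₂ ∈ U_n, ∃ σ d, (u₁ g u₂)_{ij} = [i = σ j] d_j`.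

## References

* R. W. Carter, *Finite Groups of Lie Type*, §2.5; R. Steinberg, *Lectures on Chevalley Groups*, §3
  Thm. 4; D. Bump, *Automorphic Forms and Representations*, §4.1.
-/

noncomputable section

open scoped BigOperators Matrix

namespace Literature.RepresentationTheory.FiniteGroups.GLn

variable {F : Type*} [Field F] {n : ℕ}

/-! ### Bordering a matrix along `p.succAbove` -/

/-- The index `k` with `p.succAbove k = i`, for `i ≠ p`. [folklore] -/
def predAlong (p i : Fin (n + 1)) (hi : i ≠ p) : Fin n :=
  (Fin.exists_succAbove_eq hi).choose

/-- `p.succAbove (predAlong p i) = i`. [folklore] -/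
@[simp] theorem succAbove_predAlong (p i : Fin (n + 1)) (hi : i ≠ p) : p.succAbove (predAlong p i hi) = i :=
  (Fin.exists_succAbove_eq hi).choose_spec

/-- `predAlong p (p.succAbove k) = k`. [folklore] -/
@[simp] theorem predAlong_succAbove (p : Fin (n + 1)) (k : Fin n) (h : p.succAbove k ≠ p) :
    predAlong p (p.succAbove k) h = k :=
  Fin.succAbove_right_injective (succAbove_predAlong p _ h)

/-- **`A ⊕ (1)` bordered along `p`**: the matrix with `A` on the rows and columns `≠ p` (indexed through
`p.succAbove`), `1` at `(p, p)` and `0` elsewhere in row and column `p`. [folklore] -/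
def extendAlong (p : Fin (n + 1)) (A : Matrix (Fin n) (Fin n) F) : Matrix (Fin (n + 1)) (Fin (n + 1)) F :=
  Matrix.of fun i j =>
    if hi : i = p then (if j = p then 1 else 0)
    else if hj : j = p then 0 else A (predAlong p i hi) (predAlong p j hj)

/-- The `A`-block of `extendAlong p A`. [folklore] -/
@[simp] theorem extendAlong_succAbove_succAbove (p : Fin (n + 1)) (A : Matrix (Fin n) (Fin n) F) (i j : Fin n) :
    extendAlong p A (p.succAbove i) (p.succAbove j) = A i j := by
  simp [extendAlong, Fin.succAbove_ne]

/-- The corner entry of `extendAlong p A`. [folklore] -/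
@[simp] theorem extendAlong_self_self (p : Fin (n + 1)) (A : Matrix (Fin n) (Fin n) F) :
    extendAlong p A p p = 1 := by
  simp [extendAlong]

/-- Row `p` of `extendAlong p A` off the corner vanishes. [folklore] -/
@[simp] theorem extendAlong_self_succAbove (p : Fin (n + 1)) (A : Matrix (Fin n) (Fin n) F) (j : Fin n) :
    extendAlong p A p (p.succAbove j) = 0 := by
  simp [extendAlong, Fin.succAbove_ne]

/-- Column `p` of `extendAlong p A` off the corner vanishes. [folklore] -/
@[simp] theorem extendAlong_succAbove_self (p : Fin (n + 1)) (A : Matrix (Fin n) (Fin n) F) (i : Fin n) :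
    extendAlong p A (p.succAbove i) p = 0 := by
  simp [extendAlong, Fin.succAbove_ne]

/-- Row `p` of `extendAlong p A` is `e_pᵀ`. [folklore] -/
theorem extendAlong_self_apply (p : Fin (n + 1)) (A : Matrix (Fin n) (Fin n) F) (j : Fin (n + 1)) :
    extendAlong p A p j = if j = p then 1 else 0 := by
  simp [extendAlong]

/-- Column `p` of `extendAlong p A` is `e_p`. [folklore] -/
theorem extendAlong_apply_self (p : Fin (n + 1)) (A : Matrix (Fin n) (Fin n) F) (i : Fin (n + 1)) :
    extendAlong p A i p = if i = p then 1 else 0 := by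
  unfold extendAlong
  simp only [Matrix.of_apply]
  split_ifs <;> simp_all

/-- Left multiplication by a bordered matrix: row `p`. [folklore] -/
theorem extendAlong_mul_self_apply (p : Fin (n + 1)) (A : Matrix (Fin n) (Fin n) F)
    (N : Matrix (Fin (n + 1)) (Fin (n + 1)) F) (j : Fin (n + 1)) : (extendAlong p A * N) p j = N p j := by
  rw [Matrix.mul_apply, Fin.sum_univ_succAbove _ p]
  simp

/-- Left multiplication by a bordered matrix: the other rows. [folklore] -/
theorem extendAlong_mul_succAbove_apply (p : Fin (n + 1)) (A : Matrix (Fin n) (Fin n) F)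
    (N : Matrix (Fin (n + 1)) (Fin (n + 1)) F) (i : Fin n) (j : Fin (n + 1)) :
    (extendAlong p A * N) (p.succAbove i) j = ∑ l : Fin n, A i l * N (p.succAbove l) j := by
  rw [Matrix.mul_apply, Fin.sum_univ_succAbove _ p]
  simp

/-- Right multiplication by a bordered matrix: column `p`. [folklore] -/
theorem mul_extendAlong_apply_self (p : Fin (n + 1)) (A : Matrix (Fin n) (Fin n) F)
    (N : Matrix (Fin (n + 1)) (Fin (n + 1)) F) (i : Fin (n + 1)) : (N * extendAlong p A) i p = N i p := by
  rw [Matrix.mul_apply, Fin.sum_univ_succAbove _ p]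
  simp

/-- Right multiplication by a bordered matrix: the other columns. [folklore] -/
theorem mul_extendAlong_apply_succAbove (p : Fin (n + 1)) (A : Matrix (Fin n) (Fin n) F)
    (N : Matrix (Fin (n + 1)) (Fin (n + 1)) F) (i : Fin (n + 1)) (j : Fin n) :
    (N * extendAlong p A) i (p.succAbove j) = ∑ l : Fin n, N i (p.succAbove l) * A l j := by
  rw [Matrix.mul_apply, Fin.sum_univ_succAbove _ p]
  simp

/-- Bordering preserves upper unitriangularity (`p.succAbove` is strictly monotone). [folklore] -/
theorem IsUnitUpper.extendAlong (p : Fin (n + 1)) {A : Matrix (Fin n) (Fin n) F} (hA : IsUnitUpper F n A) :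
    IsUnitUpper F (n + 1) (extendAlong p A) := by
  refine ⟨fun i j hij => ?_, fun i => ?_⟩
  · by_cases hi : i = p
    · subst hi
      rw [extendAlong_self_apply, if_neg (ne_of_lt hij)]
    · by_cases hj : j = p
      · subst hj
        rw [extendAlong_apply_self, if_neg hi]
      · obtain ⟨i', rfl⟩ := Fin.exists_succAbove_eq hi
        obtain ⟨j', rfl⟩ := Fin.exists_succAbove_eq hj
        rw [extendAlong_succAbove_succAbove]
        exact hA.1 _ _ ((Fin.strictMono_succAbove p).lt_iff_lt.mp hij)
  · by_cases hi : i = p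
    · subst hi; exact extendAlong_self_self _ _
    · obtain ⟨i', rfl⟩ := Fin.exists_succAbove_eq hi
      rw [extendAlong_succAbove_succAbove]
      exact hA.2 _

/-! ### Gaussian elimination: the induction step -/

/-- One elimination step: if the last row of `M` has its first non-zero entry `p` in column `c`,
there are unitriangular `U₁, U₂` with `H = U₁ M U₂` satisfying `H_{last, j} = p [j = c]`,
`H_{i, c} = p [i = last]`. [folklore] -/
theorem exists_elim_last_row (M : Matrix (Fin (n + 1)) (Fin (n + 1)) F) (c : Fin (n + 1))
    (hc : M (Fin.last n) c ≠ 0) (hmin : ∀ j, j < c → M (Fin.last n) j = 0) :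
    ∃ U₁ U₂ : Matrix (Fin (n + 1)) (Fin (n + 1)) F, IsUnitUpper F (n + 1) U₁ ∧ IsUnitUpper F (n + 1) U₂ ∧
      (∀ j, (U₁ * M * U₂) (Fin.last n) j = if j = c then M (Fin.last n) c else 0) ∧
      (∀ i, (U₁ * M * U₂) i c = if i = Fin.last n then M (Fin.last n) c else 0) := by
  set r := Fin.last n with hr
  set p := M r c with hp
  -- column operations: clear the last row to the right of `c`
  let R : Matrix (Fin (n + 1)) (Fin (n + 1)) F := Matrix.of fun a b => if a = c ∧ c < b then -(M r b / p) else 0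
  have hU₂ : IsUnitUpper F (n + 1) (1 + R) := by
    refine ⟨fun i j hij => ?_, fun i => ?_⟩
    · rw [Matrix.add_apply, Matrix.one_apply_ne (ne_of_gt hij)]
      simp only [R, Matrix.of_apply]
      rw [if_neg, add_zero]
      rintro ⟨rfl, h⟩; exact lt_asymm hij h
    · rw [Matrix.add_apply, Matrix.one_apply_eq]
      simp only [R, Matrix.of_apply]
      rw [if_neg, add_zero]
      rintro ⟨h1, h2⟩; rw [h1] at h2; exact lt_irrefl _ h2
  set M₁ := M * (1 + R) with hM₁
  have hM₁apply : ∀ i j, M₁ i j = M i j + if c < j then M i c * -(M r j / p) else 0 := fun i j => by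
    rw [hM₁, mul_add, mul_one, Matrix.add_apply, Matrix.mul_apply]
    congr 1
    rw [Finset.sum_eq_single c]
    · simp only [R, Matrix.of_apply, true_and]
      split_ifs <;> simp
    · intro l _ hl
      simp only [R, Matrix.of_apply, if_neg (fun h : l = c ∧ c < j => hl h.1), mul_zero]
    · simp
  have hrow : ∀ j, M₁ r j = if j = c then p else 0 := fun j => by
    rw [hM₁apply]
    rcases lt_trichotomy j c with h | h | h
    · rw [hmin j h, if_neg (not_lt.mpr h.le), if_neg (ne_of_lt h), add_zero]
    · subst h; rw [if_neg (lt_irrefl _), if_pos rfl, add_zero]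
    · rw [if_pos h, if_neg (ne_of_gt h), ← hp]
      field_simp
      ring
  -- row operations: clear column `c` above the last row
  let s : Fin (n + 1) → F := fun a => -(M₁ a c / p)
  have hU₁ : IsUnitUpper F (n + 1) (1 + colMatrix F (n + 1) r s) := isUnitUpper_one_add_colMatrix F (n + 1) r s
  have hHapply : ∀ i j, ((1 + colMatrix F (n + 1) r s) * M₁) i j =
      M₁ i j + if i < r then s i * M₁ r j else 0 := fun i j => by
    rw [add_mul, one_mul, Matrix.add_apply, Matrix.mul_apply]
    congr 1
    rw [Finset.sum_eq_single r]
    · simp only [colMatrix_apply, true_and]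
      split_ifs <;> simp
    · intro l _ hl
      rw [colMatrix_apply, if_neg (fun h => hl h.1), zero_mul]
    · simp
  refine ⟨1 + colMatrix F (n + 1) r s, 1 + R, hU₁, hU₂, fun j => ?_, fun i => ?_⟩
  · rw [Matrix.mul_assoc, ← hM₁, hHapply, if_neg (lt_irrefl _), add_zero, hrow]
  · rw [Matrix.mul_assoc, ← hM₁, hHapply, hrow, if_pos rfl]
    by_cases hi : i = r
    · subst hi; rw [if_neg (lt_irrefl _), if_pos rfl, add_zero, hrow, if_pos rfl]
    · rw [if_pos (Fin.lt_last_iff_ne_last.mpr hi), if_neg hi]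
      simp only [s]
      field_simp
      ring

/-! ### The Bruhat decomposition -/

/-- **Bruhat decomposition for matrices**: for `M` with `det M ≠ 0` there are upper unitriangular
`U₁, U₂`, a permutation `σ` and scalars `d` with `(U₁ M U₂)_{ij} = [i = σ j] d_j`. [folklore] -/
theorem exists_isUnitUpper_mul_mul_eq_monomial :
    ∀ (n : ℕ) (M : Matrix (Fin n) (Fin n) F), M.det ≠ 0 →
      ∃ U₁ U₂ : Matrix (Fin n) (Fin n) F, IsUnitUpper F n U₁ ∧ IsUnitUpper F n U₂ ∧
        ∃ (σ : Equiv.Perm (Fin n)) (d : Fin n → F), ∀ i j, (U₁ * M * U₂) i j = if i = σ j then d j else 0 := by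
  intro n
  induction n with
  | zero =>
    intro M _
    exact ⟨1, 1, isUnitUpper_one F 0, isUnitUpper_one F 0, Equiv.refl _, 0, fun i => i.elim0⟩
  | succ n ih =>
    intro M hM
    classical
    set r := Fin.last n with hr
    -- the first non-zero entry of the last row
    have hne : (Finset.univ.filter fun j => M r j ≠ 0).Nonempty := by
      by_contra h
      rw [Finset.not_nonempty_iff_eq_empty, Finset.filter_eq_empty_iff] at h
      exact hM (Matrix.det_eq_zero_of_row_eq_zero r fun j => by simpa using h (Finset.mem_univ j))
    set c := (Finset.univ.filter fun j => M r j ≠ 0).min' hne with hc'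
    have hc : M r c ≠ 0 := (Finset.mem_filter.mp (Finset.min'_mem _ hne)).2
    have hmin : ∀ j, j < c → M r j = 0 := fun j hj => by
      by_contra h
      have hmem : j ∈ Finset.univ.filter (fun j => M r j ≠ 0) := Finset.mem_filter.mpr ⟨Finset.mem_univ _, h⟩
      have := Finset.min'_le _ j hmem
      exact absurd hj (not_lt.mpr this)
    obtain ⟨U₁, U₂, hU₁, hU₂, hrow, hcol⟩ := exists_elim_last_row M c hc hmin
    set p := M r c with hp
    set H := U₁ * M * U₂ with hH
    -- the minor
    set H' : Matrix (Fin n) (Fin n) F := H.submatrix Fin.castSucc c.succAbove with hH'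
    have hdetH : H.det = M.det := by
      rw [hH, Matrix.det_mul, Matrix.det_mul, hU₁.det_eq_one, hU₂.det_eq_one, one_mul, mul_one]
    have hdetH' : H'.det ≠ 0 := by
      intro h0
      apply hM
      rw [← hdetH, Matrix.det_succ_row H r, Finset.sum_eq_single c]
      · rw [Fin.succAbove_last, ← hH', h0, mul_zero]
      · intro j _ hj
        rw [hrow j, if_neg hj, mul_zero, zero_mul]
      · simp
    obtain ⟨U₁', U₂', hU₁', hU₂', σ', d', hmono⟩ := ih H' hdetH'
    -- border the small unitriangular matrices
    refine ⟨extendAlong r U₁' * U₁, U₂ * extendAlong c U₂', IsUnitUpper.mul F (n + 1) (hU₁'.extendAlong r) hU₁,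
      IsUnitUpper.mul F (n + 1) hU₂ (hU₂'.extendAlong c), ?_⟩
    -- the permutation: `c ↦ last`, `c.succAbove j ↦ castSucc (σ' j)`
    let σf : Fin (n + 1) → Fin (n + 1) := fun j => if h : j = c then r else Fin.castSucc (σ' (predAlong c j h))
    let σg : Fin (n + 1) → Fin (n + 1) := fun i => if h : i = r then c else c.succAbove (σ'.symm (predAlong r i h))
    have hσfg : ∀ i, σf (σg i) = i := fun i => by
      by_cases h : i = r
      · subst h; simp [σf, σg]
      · simp only [σg, dif_neg h, σf, dif_neg (Fin.succAbove_ne c _), predAlong_succAbove, Equiv.apply_symm_apply]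
        rw [← Fin.succAbove_last, succAbove_predAlong]
    have hσgf : ∀ j, σg (σf j) = j := fun j => by
      by_cases h : j = c
      · subst h; simp [σf, σg]
      · have hne' : Fin.castSucc (σ' (predAlong c j h)) ≠ r := Fin.castSucc_ne_last _
        simp only [σf, dif_neg h, σg, dif_neg hne']
        have this : ∀ hh, predAlong r (Fin.castSucc (σ' (predAlong c j h))) hh = σ' (predAlong c j h) := fun hh => by
          apply Fin.succAbove_right_injective (p := r)
          rw [succAbove_predAlong, Fin.succAbove_last]
        rw [this, Equiv.symm_apply_apply, succAbove_predAlong]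
    let σ : Equiv.Perm (Fin (n + 1)) := ⟨σf, σg, hσgf, hσfg⟩
    let d : Fin (n + 1) → F := fun j => if h : j = c then p else d' (predAlong c j h)
    refine ⟨σ, d, fun i j => ?_⟩
    show (extendAlong r U₁' * U₁ * M * (U₂ * extendAlong c U₂')) i j = if i = σf j then d j else 0
    have hprod : extendAlong r U₁' * U₁ * M * (U₂ * extendAlong c U₂') = extendAlong r U₁' * H * extendAlong c U₂' := by
      rw [hH]; simp only [Matrix.mul_assoc]
    rw [hprod]
    by_cases hj : j = c
    · subst hj
      simp only [σf, d, dif_pos rfl]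
      rw [mul_extendAlong_apply_self]
      by_cases hi : i = r
      · subst hi
        rw [extendAlong_mul_self_apply, hcol]
      · obtain ⟨i', rfl⟩ := Fin.exists_succAbove_eq hi
        rw [extendAlong_mul_succAbove_apply, if_neg hi]
        refine Finset.sum_eq_zero fun l _ => ?_
        rw [hcol, Fin.succAbove_last, if_neg (Fin.castSucc_ne_last _), mul_zero]
    · obtain ⟨j', rfl⟩ := Fin.exists_succAbove_eq hj
      simp only [σf, d, dif_neg hj, predAlong_succAbove]
      rw [mul_extendAlong_apply_succAbove]
      by_cases hi : i = r
      · subst hi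
        simp only [extendAlong_mul_self_apply]
        rw [if_neg (Fin.castSucc_ne_last _).symm]
        refine Finset.sum_eq_zero fun l _ => ?_
        rw [hrow, if_neg (Fin.succAbove_ne c l), zero_mul]
      · obtain ⟨i', rfl⟩ := Fin.exists_succAbove_eq hi
        simp only [extendAlong_mul_succAbove_apply]
        -- `∑_l (∑_k U₁'_{i'k} H_{castSucc k, c.succAbove l}) U₂'_{l j'} = (U₁' H' U₂')_{i' j'}`
        have key : ∑ l, (∑ k, U₁' i' k * H (r.succAbove k) (c.succAbove l)) * U₂' l j' = (U₁' * H' * U₂') i' j' := by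
          rw [Matrix.mul_apply]
          refine Finset.sum_congr rfl fun l _ => ?_
          rw [Matrix.mul_apply]
          congr 1
          refine Finset.sum_congr rfl fun k _ => ?_
          rw [hH', Matrix.submatrix_apply, Fin.succAbove_last]
        rw [key, hmono, Fin.succAbove_last]
        simp only [Fin.castSucc_inj]

/-- **Bruhat decomposition of `GL_n(F)`** (existence): every `g` is `u₁⁻¹ m u₂⁻¹` with `u₁, u₂ ∈ U_n`
and `m` monomial — `GL_n(F) = U N U`. [folklore] -/
theorem exists_bruhat (g : GL (Fin n) F) :
    ∃ u₁ ∈ unitUpper F n, ∃ u₂ ∈ unitUpper F n, ∃ (σ : Equiv.Perm (Fin n)) (d : Fin n → F),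
      ∀ i j, (u₁ * g * u₂).val i j = if i = σ j then d j else 0 := by
  have hdet : g.val.det ≠ 0 := by
    have := g.isUnit
    rw [Matrix.isUnit_iff_isUnit_det] at this
    exact this.ne_zero
  obtain ⟨U₁, U₂, hU₁, hU₂, σ, d, h⟩ := exists_isUnitUpper_mul_mul_eq_monomial n g.val hdet
  refine ⟨unitUpperMk F n U₁ hU₁, unitUpperMk_mem F n U₁ hU₁, unitUpperMk F n U₂ hU₂, unitUpperMk_mem F n U₂ hU₂,
    σ, d, fun i j => ?_⟩
  rw [Units.val_mul, Units.val_mul, coe_unitUpperMk, coe_unitUpperMk]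
  exact h i j

end Literature.RepresentationTheory.FiniteGroups.GLn

end
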